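import Summits.QuantumFields.YangMills.Theorems.BalabanUVNodesN15DefectKernelVectorPiece
import Summits.QuantumFields.YangMills.Theorems.BalabanUVNodesN15LaplacianOfMinimizer
import HarnessLib

/-!
# Route «BalabanUVNodes» (K4 «SpineRates»), node N15 = NE2, -a lane, part 20: THE STENCIL OF BAŁABAN'S BLOCK AVERAGING `Q_k` (1.18) ALONG A
# LINE — `n^{d+2}·Q_k((z,κ),(x,κ)) = #{t < n : B(x − tη e_κ) = z} = (a_κ+1)·[z = B(x)] + (n−1−a_κ)·[z + e_κ = B(x)]` (`x = n·B(x) + a`), its range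
# (`≤ 1` block) and its TWO-LATTICE DISCREPANCY through King's pairing (`≤ 1∕n`)

Cell `pub-ymgap`, seat `pub-ymgap-dag-n15-a` (KNIT-BY-NAME, generation g4; HUMAN RULING D-0062; chair R424 venue; `bears_on: R4∕N15`).  Filed
`--supports stmt-QuantumFields-19351` (helper).  THEOREMS ONLY; imports the b05 lineage BY NAME through part 8 (`B5Block118.QvOp`∕`bpt`∕`tstep`∕
`bpt_add_tstep`, `B5Blocks16.bpt_val`∕`bpt_bijective`, `Beta.FluctuationProjection.bpt_add_tstep_of_lt`, King's `blockOf`∕`val_blockOf`∕`tdistT`, part 8's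
`pr_bpt`∕`blockOf_bpt_king`, part 9's `kingBlockOf_bpt`); nothing in the tree is modified; nothing printed is a hypothesis.

WHY (parts 18–19: the fourth (3.42) entry of the vector piece is `Q_kᴴ·(H_kᴴ(Δ−∂∂*)H_k)·C^{(k)}·(η^{d+1}H_kᵀ)` with `Re(H_kᴴ(Δ−∂∂*)H_k) = n^d·deltaPol`).  The entry
`((Δ−∂∂*)H_k)((x,κ),(y,λ)) = Σ_z n^dQ_k((z,κ),(x,κ))·Δ_k((z,κ),(y,λ))` is an AVERAGE of `Δ_k`'s entries over the blocks `z` met by the backward line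
`{x − tηe_κ : t < n}` ((1.18): «(Q_kA)_b = Σ_{x∈B^k(b₋)} η^{d+1}A([x, x(b)])», the straight line of `n` fine bonds from `x`).  THIS FILE computes that
stencil: the line meets only `B(x)` (`a_κ + 1` times) and `B(x) − e_κ` (`n − 1 − a_κ` times), so the weights are `θ = (a_κ+1)∕n`, `1 − θ` on two
ADJACENT blocks, and under King's pairing `x = pr x′` (`a′_κ = Ra_κ + r`) the weights of the two runs differ by at most `1∕n` — the two facts the
kernel lemmas of part 21 (uniform decay and two-lattice rate of `((Δ−∂∂*)H_k)`'s entries from `kernelDecay166`∕`kernelRate166`) consume.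

CONTENTS.  §1 `tstep_add`, `bpt_sub_tstep_of_le` ∕ `bpt_sub_tstep_of_lt` (the backward line point `n·y + a − te_κ` is `n·y + (a − te_κ)` for `t ≤ a_κ` and
`n·(y − e_κ) + (a + (n−t)e_κ)` for `a_κ < t < n`), `blockOf_bpt_sub_tstep` (its block is `y` resp. `y − e_κ`), `tdistT_blockOf_sub_tstep_le` (`≤ 1` from `B(x)`).
§2 `sum_indicator_line_eq` (`Σ_j [x = n·z + j + te_κ] = [B(x − te_κ) = z]`), **`QvOp_apply_eq`** (`Q_k((z,ι),(x,κ)) = [ι = κ]·n^{−(d+2)}·#{t < n : B(x − te_κ) = z}`, dimension `d + 1`),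
**`lineCount_bpt`** (`#{t < n : B(n·y + a − te_κ) = z} = (a_κ+1)[z = y] + (n−1−a_κ)[z + e_κ = y]`).  §3 the weight `lineWeight n M κ x z := #{…}∕n`:
`lineWeight_nonneg`, `lineWeight_le_one`, `lineWeight_eq_zero_of` (support on `{B(x), B(x) − e_κ}`), `QvOp_re_eq_lineWeight` (`n^{d+1}Re Q_k = θ`), **`abs_lineWeight_pair_sub_le`** (`|θ′(x′,z) − θ(pr x′,z)| ≤ 1∕n`
and `= 0` off the two blocks).

HONEST FRAMING ∕ LIMITS.  Elementary lattice combinatorics of the typed (1.18) on the b05 tori (every `n ≥ 1`, `M`, `d`); no estimate of Bałaban's is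
involved; count-neutral (typed 28∕28 · discharged unchanged); NOT a discharge of N15; one finite T⁴ at fixed ε — NOT infinite volume, NOT OS on ℝ⁴,
NOT a mass gap, NOT Clay.
-/

noncomputable section

open scoped BigOperators
open Finset

namespace Summit.QuantumFields.YangMills.BalabanUVNodes.N15.VectorPiece

open Literature.MathematicalPhysics.QuantumFieldTheory.Balaban1983to89
open Literature.MathematicalPhysics.QuantumFieldTheory.Balaban1983to89.B5Prop11Plancherel (Tor fine unitVec)
open Literature.MathematicalPhysics.QuantumFieldTheory.Balaban1983to89.B5Block118 (bpt tstep QvOp bpt_add_tstep tstep_zero)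
open Literature.MathematicalPhysics.QuantumFieldTheory.Balaban1983to89.B5Blocks16 (bpt_val bpt_bijective bpt_injective)
open Literature.MathematicalPhysics.QuantumFieldTheory.Balaban1983to89.Beta.FluctuationProjection (bpt_add_tstep_of_lt)
open Literature.MathematicalPhysics.QuantumFieldTheory.King1986.Torus (blockOf val_blockOf tdistT tdistT_sub_unitVec_le tdistT_self tdistT_symm)
open Summit.QuantumFields.YangMills.BalabanUVNodes.N15.DefectKernel (kingBlockOf_bpt pr_bpt)

variable {d : ℕ} (n : ℕ) [NeZero n] (M : Fin (d + 1) → ℕ) [hM : ∀ μ, NeZero (M μ)]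

/-! ## §1 The backward line from a fine point and the blocks it meets -/

omit [NeZero n] hM in
/-- `(s + t)e_κ = se_κ + te_κ`. [folklore] -/
theorem tstep_add (κ : Fin (d + 1)) (s t : ℕ) : tstep (fine n M) κ (s + t) = tstep (fine n M) κ s + tstep (fine n M) κ t := by
  funext ν
  by_cases h : ν = κ <;> simp [tstep, h]

omit [NeZero n] hM in
/-- Inside the block: `n·y + a − te_κ = n·y + (a − te_κ)` for `t ≤ a_κ`. [cite: Balaban1984PropagatorsI, (1.6) p.18, (1.18) p.20] -/
theorem bpt_sub_tstep_of_le (y : Tor M) (a : Fin (d + 1) → Fin n) (κ : Fin (d + 1)) {t : ℕ} (ht : t ≤ (a κ : ℕ)) :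
    bpt n M y a - tstep (fine n M) κ t = bpt n M y (Function.update a κ ⟨(a κ : ℕ) - t, by omega⟩) := by
  have h := bpt_add_tstep_of_lt n M y (Function.update a κ ⟨(a κ : ℕ) - t, by omega⟩) κ t
    (by rw [Function.update_self]; show (a κ : ℕ) - t + t < n; omega)
  rw [sub_eq_iff_eq_add, h, Function.update_idem]
  congr 1
  funext ν
  by_cases hν : ν = κ
  · subst hν; rw [Function.update_self]; apply Fin.ext; simp only [Function.update_self]; omega
  · rw [Function.update_of_ne hν]

omit [NeZero n] hM in
/-- Into the previous block: `n·y + a − te_κ = n·(y − e_κ) + (a + (n − t)e_κ)` for `a_κ < t < n`. [cite: Balaban1984PropagatorsI, (1.6) p.18, (1.18) p.20] -/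
theorem bpt_sub_tstep_of_lt (y : Tor M) (a : Fin (d + 1) → Fin n) (κ : Fin (d + 1)) {t : ℕ} (ht : (a κ : ℕ) < t) (htn : t < n) :
    bpt n M y a - tstep (fine n M) κ t = bpt n M (y - unitVec M κ) (Function.update a κ ⟨(a κ : ℕ) + (n - t), by omega⟩) := by
  -- `n·(y − e_κ) + a + ne_κ = n·y + a`
  have h1 : bpt n M (y - unitVec M κ) a + tstep (fine n M) κ n = bpt n M y a := by
    rw [bpt_add_tstep, sub_add_cancel]
  have h2 := bpt_add_tstep_of_lt n M (y - unitVec M κ) a κ (n - t) (by omega)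
  rw [sub_eq_iff_eq_add, ← h2, add_assoc, ← tstep_add, show n - t + t = n by omega, h1]

/-- **The block of a backward line point**: `B(n·y + a − te_κ) = y` if `t ≤ a_κ`, `= y − e_κ` if `a_κ < t < n`. [cite: Balaban1984PropagatorsI, (1.6) p.18] -/
theorem blockOf_bpt_sub_tstep (y : Tor M) (a : Fin (d + 1) → Fin n) (κ : Fin (d + 1)) {t : ℕ} (htn : t < n) :
    blockOf n M (bpt n M y a - tstep (fine n M) κ t) = if t ≤ (a κ : ℕ) then y else y - unitVec M κ := by
  split_ifs with ht
  · rw [bpt_sub_tstep_of_le n M y a κ ht, kingBlockOf_bpt]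
  · rw [bpt_sub_tstep_of_lt n M y a κ (lt_of_not_ge ht) htn, kingBlockOf_bpt]

/-- The backward line stays within ONE block of `B(x)`: `|B(x − te_κ) − B(x)|_T ≤ 1` (`t < n`). [folklore] -/
theorem tdistT_blockOf_sub_tstep_le (x : Tor (fine n M)) (κ : Fin (d + 1)) {t : ℕ} (htn : t < n) :
    tdistT M (blockOf n M (x - tstep (fine n M) κ t)) (blockOf n M x) ≤ 1 := by
  obtain ⟨⟨y, a⟩, rfl⟩ := (bpt_bijective n M).2 x
  simp only
  rw [blockOf_bpt_sub_tstep n M y a κ htn, kingBlockOf_bpt]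
  split_ifs
  · rw [tdistT_self]; exact zero_le_one
  · rw [tdistT_symm]; exact tdistT_sub_unitVec_le M y κ

/-! ## §2 The (1.18) stencil: `Q_k((z,ι),(x,κ))` counts the backward line points of `x` in the block `z` -/

/-- For fixed `t`, exactly one offset `j` puts `x` on the line from `B(z)` iff `B(x − te_κ) = z`: `Σ_j [x = n·z + j + te_κ] = [B(x − te_κ) = z]`. [folklore] -/
theorem sum_indicator_line_eq (z : Tor M) (x : Tor (fine n M)) (κ : Fin (d + 1)) (t : ℕ) (c : ℂ) :
    (∑ j : Fin (d + 1) → Fin n, if x = bpt n M z j + tstep (fine n M) κ t then c else 0)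
      = if blockOf n M (x - tstep (fine n M) κ t) = z then c else 0 := by
  classical
  obtain ⟨⟨y, a⟩, hx⟩ := (bpt_bijective n M).2 (x - tstep (fine n M) κ t)
  simp only at hx
  have hx' : x = bpt n M y a + tstep (fine n M) κ t := by rw [hx, sub_add_cancel]
  have hiff : ∀ j : Fin (d + 1) → Fin n, x = bpt n M z j + tstep (fine n M) κ t ↔ (z, j) = (y, a) := by
    intro j
    rw [hx', add_left_inj]
    constructor
    · intro h; exact (bpt_injective n M (a₁ := (z, j)) (a₂ := (y, a)) h.symm)
    · intro h; rw [Prod.mk.injEq] at h; rw [h.1, h.2]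
  simp_rw [hiff, Prod.mk.injEq]
  rw [← hx, kingBlockOf_bpt]
  by_cases hz : z = y
  · subst hz
    simp only [true_and, if_true]
    rw [Finset.sum_ite_eq' Finset.univ a (fun _ => c), if_pos (Finset.mem_univ _)]
  · have hz' : ¬ y = z := fun h => hz h.symm
    simp [hz, hz']

/-- **THE (1.18) STENCIL** (dimension `d + 1`, so `η^{(d+1)+1} = n^{−(d+2)}`): `Q_k((z,ι),(x,κ)) = [ι = κ]·n^{−(d+2)}·#{t < n : B(x − te_κ) = z}`.
[cite: Balaban1984PropagatorsI, (1.18) p.20] -/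
theorem QvOp_apply_eq (z : Tor M) (ι : Fin (d + 1)) (x : Tor (fine n M)) (κ : Fin (d + 1)) :
    QvOp n M (z, ι) (x, κ)
      = if κ = ι then (((Finset.univ.filter fun t : Fin n => blockOf n M (x - tstep (fine n M) κ (t : ℕ)) = z).card : ℕ) : ℂ)
          / (n : ℂ) ^ (d + 2) else 0 := by
  classical
  unfold QvOp
  dsimp only
  split_ifs with h
  · subst h
    rw [Finset.sum_comm]
    simp_rw [sum_indicator_line_eq n M z x κ _ (1 / (n : ℂ) ^ (d + 1 + 1))]
    rw [Finset.sum_ite, Finset.sum_const_zero, add_zero, Finset.sum_const, nsmul_eq_mul]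
    ring
  · rfl

/-- **THE COUNT**: `#{t < n : B(n·y + a − te_κ) = z} = (a_κ + 1)·[z = y] + (n − 1 − a_κ)·[z + e_κ = y]` (if `M_κ = 1` both brackets may hold and the
count is `n`). [cite: Balaban1984PropagatorsI, (1.18) p.20 (the line of n bonds)] -/
theorem lineCount_bpt (y z : Tor M) (a : Fin (d + 1) → Fin n) (κ : Fin (d + 1)) :
    (Finset.univ.filter fun t : Fin n => blockOf n M (bpt n M y a - tstep (fine n M) κ (t : ℕ)) = z).card
      = (if z = y then (a κ : ℕ) + 1 else 0) + (if z + unitVec M κ = y then n - 1 - (a κ : ℕ) else 0) := by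
  classical
  have hsplit : (Finset.univ.filter fun t : Fin n => blockOf n M (bpt n M y a - tstep (fine n M) κ (t : ℕ)) = z)
      = (Finset.univ.filter fun t : Fin n => (t : ℕ) ≤ (a κ : ℕ) ∧ y = z)
        ∪ (Finset.univ.filter fun t : Fin n => ¬ (t : ℕ) ≤ (a κ : ℕ) ∧ y - unitVec M κ = z) := by
    ext t
    simp only [Finset.mem_filter, Finset.mem_univ, true_and, Finset.mem_union]
    rw [blockOf_bpt_sub_tstep n M y a κ t.isLt]
    split_ifs with h <;> simp [h]
  have hdisj : Disjoint (Finset.univ.filter fun t : Fin n => (t : ℕ) ≤ (a κ : ℕ) ∧ y = z)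
      (Finset.univ.filter fun t : Fin n => ¬ (t : ℕ) ≤ (a κ : ℕ) ∧ y - unitVec M κ = z) :=
    Finset.disjoint_filter.mpr fun t _ h1 h2 => h2.1 h1.1
  rw [hsplit, Finset.card_union_of_disjoint hdisj]
  congr 1
  · by_cases hz : z = y
    · subst hz
      simp only [and_true, if_true]
      have : (Finset.univ.filter fun t : Fin n => (t : ℕ) ≤ (a κ : ℕ)) = Finset.Iic (a κ) := by
        ext t; simp only [Finset.mem_filter, Finset.mem_univ, true_and, Finset.mem_Iic, Fin.le_def]
      rw [this, Fin.card_Iic]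
    · have hz' : ¬ y = z := fun h => hz h.symm
      simp [hz, hz']
  · by_cases hz : z + unitVec M κ = y
    · have hz' : y - unitVec M κ = z := by rw [← hz, add_sub_cancel_right]
      simp only [hz', and_true, if_true, hz]
      have : (Finset.univ.filter fun t : Fin n => ¬ (t : ℕ) ≤ (a κ : ℕ)) = Finset.Ioi (a κ) := by
        ext t; simp only [Finset.mem_filter, Finset.mem_univ, true_and, Finset.mem_Ioi, Fin.lt_def, not_le]
      rw [this, Fin.card_Ioi]
    · have hz' : ¬ y - unitVec M κ = z := fun h => hz (by rw [← h, sub_add_cancel])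
      simp [hz, hz']

/-! ## §3 The normalised line weight and its two-lattice discrepancy under King's pairing -/

/-- THE LINE WEIGHT `θ_n(x, z; κ) := #{t < n : B(x − te_κ) = z} ∕ n` — so that `n^dQ_k((z,κ),(x,κ)) = θ_n(x,z;κ)` (`QvOp_apply_eq`); the weights over `z` sum
to `1`. [cite: Balaban1984PropagatorsI, (1.18) p.20] -/
def lineWeight (κ : Fin (d + 1)) (x : Tor (fine n M)) (z : Tor M) : ℝ :=
  ((Finset.univ.filter fun t : Fin n => blockOf n M (x - tstep (fine n M) κ (t : ℕ)) = z).card : ℝ) / n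

/-- `0 ≤ θ`. [folklore] -/
theorem lineWeight_nonneg (κ : Fin (d + 1)) (x : Tor (fine n M)) (z : Tor M) : 0 ≤ lineWeight n M κ x z := by
  unfold lineWeight; positivity

/-- `θ ≤ 1`. [folklore] -/
theorem lineWeight_le_one (κ : Fin (d + 1)) (x : Tor (fine n M)) (z : Tor M) : lineWeight n M κ x z ≤ 1 := by
  have hn : (0 : ℝ) < n := by exact_mod_cast Nat.pos_of_ne_zero (NeZero.ne n)
  unfold lineWeight
  rw [div_le_one hn]
  exact_mod_cast (Finset.card_filter_le _ _).trans (by rw [Finset.card_univ, Fintype.card_fin])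

/-- The weight vanishes off the two blocks `B(x)`, `B(x) − e_κ`. [folklore] -/
theorem lineWeight_eq_zero_of (κ : Fin (d + 1)) (x : Tor (fine n M)) {z : Tor M} (h1 : z ≠ blockOf n M x) (h2 : z + unitVec M κ ≠ blockOf n M x) :
    lineWeight n M κ x z = 0 := by
  obtain ⟨⟨y, a⟩, rfl⟩ := (bpt_bijective n M).2 x
  simp only [kingBlockOf_bpt] at h1 h2 ⊢
  unfold lineWeight
  rw [lineCount_bpt, if_neg h1, if_neg h2, add_zero, Nat.cast_zero, zero_div]

/-- A nonzero weight puts `z` within one block of `B(x)`. [folklore] -/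
theorem tdistT_le_one_of_lineWeight_ne_zero (κ : Fin (d + 1)) (x : Tor (fine n M)) {z : Tor M} (h : lineWeight n M κ x z ≠ 0) :
    tdistT M z (blockOf n M x) ≤ 1 := by
  classical
  unfold lineWeight at h
  have hc : (Finset.univ.filter fun t : Fin n => blockOf n M (x - tstep (fine n M) κ (t : ℕ)) = z).card ≠ 0 := by
    intro h0; apply h; rw [h0, Nat.cast_zero, zero_div]
  obtain ⟨t, ht⟩ := Finset.card_ne_zero.mp hc
  rw [Finset.mem_filter] at ht
  rw [← ht.2]
  exact tdistT_blockOf_sub_tstep_le n M x κ t.isLt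

/-- The real part of the (1.18) entry IS the line weight over `n^{d+1} = η^{−(d+1)}`: `Re Q_k((z,κ),(x,κ))·n^{d+1} = θ_n(x,z;κ)` and the
off-direction entries vanish. [cite: Balaban1984PropagatorsI, (1.18) p.20] -/
theorem QvOp_re_eq_lineWeight (z : Tor M) (ι : Fin (d + 1)) (x : Tor (fine n M)) (κ : Fin (d + 1)) :
    (QvOp n M (z, ι) (x, κ)).re * (n : ℝ) ^ (d + 1) = if κ = ι then lineWeight n M κ x z else 0 := by
  have hn : (n : ℝ) ≠ 0 := by exact_mod_cast NeZero.ne n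
  rw [QvOp_apply_eq]
  split_ifs with h
  · unfold lineWeight
    have : ((((Finset.univ.filter fun t : Fin n => blockOf n M (x - tstep (fine n M) κ (t : ℕ)) = z).card : ℕ) : ℂ)
        / (n : ℂ) ^ (d + 2)).re
        = ((Finset.univ.filter fun t : Fin n => blockOf n M (x - tstep (fine n M) κ (t : ℕ)) = z).card : ℝ) / (n : ℝ) ^ (d + 2) := by
      rw [show ((n : ℂ) ^ (d + 2)) = (((n : ℝ) ^ (d + 2) : ℝ) : ℂ) by push_cast; ring, ← Complex.ofReal_natCast, ← Complex.ofReal_div,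
        Complex.ofReal_re]
    rw [this, pow_succ]
    field_simp
  · simp

/-- The (1.18) entries are real. [folklore] -/
theorem QvOp_im_eq_zero (z : Tor M) (ι : Fin (d + 1)) (x : Tor (fine n M)) (κ : Fin (d + 1)) : (QvOp n M (z, ι) (x, κ)).im = 0 := by
  rw [QvOp_apply_eq]
  split_ifs
  · rw [show ((n : ℂ) ^ (d + 2)) = (((n : ℝ) ^ (d + 2) : ℝ) : ℂ) by push_cast; ring, ← Complex.ofReal_natCast, ← Complex.ofReal_div,
      Complex.ofReal_im]
  · simp

/-- **THE TWO-LATTICE DISCREPANCY OF THE WEIGHTS THROUGH KING'S PAIRING**: for the fine point `x′ = Rn·y + a′` of the finer run and its King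
partner `pr x′ = n·y + â` (`â_ν = ⌊a′_ν∕R⌋`): `|θ_{Rn}(x′, z; κ) − θ_n(pr x′, z; κ)| ≤ ([z = y] + [z + e_κ = y])∕n` — both runs weight only the blocks
`y`, `y − e_κ`, with `(a′_κ+1)∕(Rn)` vs `(â_κ+1)∕n`, `a′_κ = Râ_κ + r`, `0 ≤ r < R`. [cite: King1986, p.664 (the pairing); Balaban1984PropagatorsI, (1.18) p.20] -/
theorem abs_lineWeight_pair_sub_le (R : ℕ) [NeZero R] (y z : Tor M) (a' : Fin (d + 1) → Fin (R * n)) (ah : Fin (d + 1) → Fin n)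
    (hover : ∀ ν, (a' ν : ℕ) / R = (ah ν : ℕ)) (κ : Fin (d + 1)) :
    |lineWeight (R * n) M κ (bpt (R * n) M y a') z - lineWeight n M κ (bpt n M y ah) z|
      ≤ ((if z = y then 1 else 0) + (if z + unitVec M κ = y then 1 else 0)) / n := by
  have hn : (0 : ℝ) < n := by exact_mod_cast Nat.pos_of_ne_zero (NeZero.ne n)
  have hR : (0 : ℝ) < R := by exact_mod_cast Nat.pos_of_ne_zero (NeZero.ne R)
  have hRn : (0 : ℝ) < R * n := mul_pos hR hn
  -- `a′_κ = R·â_κ + r`, `0 ≤ r < R`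
  have hdm := Nat.div_add_mod (a' κ : ℕ) R
  rw [hover κ] at hdm
  have hr : (a' κ : ℕ) % R < R := Nat.mod_lt _ (Nat.pos_of_ne_zero (NeZero.ne R))
  have ha'lt : (a' κ : ℕ) < R * n := (a' κ).isLt
  have hah : (ah κ : ℕ) < n := (ah κ).isLt
  -- the elementary inequality: `|A∕(Rn) − B∕n| ≤ 1∕n` when `|A − R·B| ≤ R`
  have frac : ∀ A B : ℝ, |A - R * B| ≤ R → |A / ((R * n : ℕ) : ℝ) - B / n| ≤ 1 / n := by
    intro A B h
    have hcast : ((R * n : ℕ) : ℝ) = R * n := by push_cast; ring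
    rw [hcast, show B / (n : ℝ) = R * B / (R * n) by field_simp, ← sub_div, abs_div, abs_of_pos hRn,
      div_le_div_iff₀ hRn hn]
    nlinarith [abs_nonneg (A - R * B)]
  have hrR : ((((a' κ : ℕ) % R : ℕ)) : ℝ) + 1 ≤ R := by exact_mod_cast hr
  have hr0 : (0 : ℝ) ≤ ((((a' κ : ℕ) % R : ℕ)) : ℝ) := Nat.cast_nonneg _
  have hR1 : (1 : ℝ) ≤ R := by exact_mod_cast Nat.pos_of_ne_zero (NeZero.ne R)
  unfold lineWeight
  rw [lineCount_bpt, lineCount_bpt]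
  by_cases h1 : z = y <;> by_cases h2 : z + unitVec M κ = y
  · -- both brackets: the two weights are `1` and `1`
    rw [if_pos h1, if_pos h2, if_pos h1, if_pos h2, if_pos h1, if_pos h2]
    rw [show (a' κ : ℕ) + 1 + (R * n - 1 - (a' κ : ℕ)) = R * n by omega, show (ah κ : ℕ) + 1 + (n - 1 - (ah κ : ℕ)) = n by omega,
      div_self (by exact_mod_cast (Nat.pos_of_ne_zero (NeZero.ne (R * n))).ne'), div_self hn.ne', sub_self, abs_zero]
    positivity
  · rw [if_pos h1, if_neg h2, if_pos h1, if_neg h2, if_pos h1, if_neg h2, add_zero, add_zero, add_zero]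
    refine (frac _ _ ?_).trans (le_of_eq (by ring))
    rw [← hdm]; push_cast
    rw [abs_le]; constructor <;> linarith
  · rw [if_neg h1, if_pos h2, if_neg h1, if_pos h2, if_neg h1, if_pos h2, zero_add, zero_add, zero_add]
    refine (frac _ _ ?_).trans (le_of_eq (by ring))
    rw [Nat.cast_sub (by omega), Nat.cast_sub (by omega), Nat.cast_sub (by omega), Nat.cast_sub (by omega)]
    rw [← hdm]; push_cast
    rw [abs_le]; constructor <;> linarith
  · rw [if_neg h1, if_neg h2, if_neg h1, if_neg h2, if_neg h1, if_neg h2]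
    simp

end Summit.QuantumFields.YangMills.BalabanUVNodes.N15.VectorPiece
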